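import Summits.CriticalPhenomena.PercolationContinuityZ3.Theorems.Transplant.FKConnectivityAllQForestQuotientMono
import Summits.CriticalPhenomena.PercolationContinuityZ3.Theorems.Transplant.FKConnectivityAllQForestAdjacentPathGadgetStar
import Summits.CriticalPhenomena.PercolationContinuityZ3.Theorems.Transplant.FKConnectivityAllQForestAdjacentDegThree
import Summits.CriticalPhenomena.PercolationContinuityZ3.Theorems.Transplant.FKConnectivityAllQArborealContraction
import Summits.CriticalPhenomena.PercolationContinuityZ3.Theorems.Transplant.FKConnectivityAllQForestAdjacentTwoSum
import Literature.Probability.LatticeModels.RandomClusterFKG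
import HarnessLib

/-!
# The path-gadget sign fact, and the node on star sides, from quotient monotonicity

builds on p205010 (kernel theorem, internal audit signed; external expert review pending).  No definitions, no named facts, no sorries;
standard axioms.

Memo bschramm/FROM-fk-1-g20-SEPARATOR-EXCHANGE.md §3d.  `…ForestQuotientMono` reduced the two-point attachment inequality to the
quotient-monotonicity family (QS-K).  Here the pinned pair `f = oy` is removed (`fibreCount_insert_one`, `isForestCfg_insert_iff`,
`reachable_sup_edge_imp`) to obtain the sign fact `n(pq,d;f) ≤ n(d,pq;f)` in the format of `…PathGadgetAssembly`/`…PathGadgetStar`, and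
the node across a path-gadget 3-separator whose first side is a star at `v` follows from (QS-K) ALONE (`adjForestNoSq_fibre_of_pathGadget_star`).
* `tracePq_insert_iff`, `traceDisc_insert_iff` — the classes with and without the pinned pair;
* `ncard_signFact_eq_fibreCount`, `ncard_signFact'_eq_fibreCount` — the two sides of the sign fact as fibre counts on `(M ∖ f, u)`;
* **`pathGadget_signFact_of_quotientMono`** — (QS-K) ⇒ `#T ≤ #T'`;
* **`adjForestNoSq_fibre_of_pathGadget_star_of_quotientMono`** — (QS-K) ⇒ the node across every star-sided path-gadget separator;
* **`adjForestNoSq_fibre_of_pathGadget_of_quotientMono`** — (QS-K) ⇒ the node across EVERY path-gadget 3-separator (both sign facts).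
[cite: SempleWelsh2008, Conj. 1.1 (p. 2)] [cite: Linusson2011, Prop. 2.6] [cite: Grimmett2006, §3.8 (pp. 61–62); §4.2 Lemma (4.13)]
-/

noncomputable section

namespace Summit.CriticalPhenomena.PercolationContinuityZ3.Theorems

namespace FK

open Set SimpleGraph Literature.Probability.LatticeModels Literature.Probability.Percolation
open scoped Classical symmDiff

variable {V : Type*} [Fintype V]

section SignFact

variable {Mf u ω : BondConfig V} {o p q y : V}

omit [Fintype V] in
/-- Reachability after inserting the pair `oy`. [folklore] -/
theorem reachable_insert_imp (h : (openGraph (insert s(o, y) ω)).Reachable p q) :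
    (openGraph ω).Reachable p q ∨ ((openGraph ω).Reachable p o ∧ (openGraph ω).Reachable y q) ∨
      ((openGraph ω).Reachable p y ∧ (openGraph ω).Reachable o q) := by
  rw [openGraph_insert_eq_sup_edge] at h
  exact reachable_sup_edge_imp _ o y h

omit [Fintype V] in
/-- **The first class of type `{pq}` with the pinned pair `f = oy`, described without `f`.** [folklore] -/
theorem tracePq_insert_iff (hoy : o ≠ y) (hf : s(o, y) ∉ ω) :
    (IsForestCfg (insert s(o, y) ω) ∧ ((openGraph (insert s(o, y) ω)).Reachable p q ∧
      ¬ (openGraph (insert s(o, y) ω)).Reachable o p ∧ ¬ (openGraph (insert s(o, y) ω)).Reachable o q)) ↔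
    (IsForestCfg ω ∧ ((openGraph ω).Reachable p q ∧ ¬ (openGraph ω).Reachable o p ∧ ¬ (openGraph ω).Reachable o q) ∧
      (¬ (openGraph ω).Reachable y o ∧ ¬ (openGraph ω).Reachable y p ∧ ¬ (openGraph ω).Reachable y q)) := by
  have hle : openGraph ω ≤ openGraph (insert s(o, y) ω) := openGraph_mono (subset_insert _ _)
  have hoy' : (openGraph (insert s(o, y) ω)).Reachable o y :=
    Adj.reachable ((openGraph_adj _ o y).2 ⟨mem_insert _ _, hoy⟩)
  rw [isForestCfg_insert_iff hoy hf]
  constructor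
  · rintro ⟨⟨hF, hnoy⟩, hpq, hop, hoq⟩
    have hyp : ¬ (openGraph ω).Reachable y p := fun h => hop (hoy'.trans (h.mono hle))
    have hyq : ¬ (openGraph ω).Reachable y q := fun h => hoq (hoy'.trans (h.mono hle))
    refine ⟨hF, ⟨?_, fun h => hop (h.mono hle), fun h => hoq (h.mono hle)⟩, fun h => hnoy h.symm, hyp, hyq⟩
    rcases reachable_insert_imp hpq with h | ⟨h, -⟩ | ⟨-, h⟩
    · exact h
    · exact absurd (h.symm.mono hle) hop
    · exact absurd (h.mono hle) hoq
  · rintro ⟨hF, ⟨hpq, hop, hoq⟩, hyo, hyp, hyq⟩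
    refine ⟨⟨hF, fun h => hyo h.symm⟩, hpq.mono hle, fun h => ?_, fun h => ?_⟩
    · rcases reachable_insert_imp h with h | ⟨-, h⟩ | ⟨-, h⟩
      exacts [hop h, hyp h, hop h]
    · rcases reachable_insert_imp h with h | ⟨-, h⟩ | ⟨-, h⟩
      exacts [hoq h, hyq h, hoq h]

omit [Fintype V] in
/-- **The first class of discrete type with the pinned pair `f = oy`, described without `f`.** [folklore] -/
theorem traceDisc_insert_iff (hoy : o ≠ y) (hyp : y ≠ p) (hyq : y ≠ q) (hf : s(o, y) ∉ ω) :
    (IsForestCfg (insert s(o, y) ω) ∧ ∀ x ∈ ({o, p, q} : Set V), ∀ x' ∈ ({o, p, q} : Set V),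
      (openGraph (insert s(o, y) ω)).Reachable x x' → x = x') ↔
    (IsForestCfg ω ∧ ∀ x ∈ insert y ({o, p, q} : Set V), ∀ x' ∈ insert y ({o, p, q} : Set V),
      (openGraph ω).Reachable x x' → x = x') := by
  have hle : openGraph ω ≤ openGraph (insert s(o, y) ω) := openGraph_mono (subset_insert _ _)
  have hoy' : (openGraph (insert s(o, y) ω)).Reachable o y :=
    Adj.reachable ((openGraph_adj _ o y).2 ⟨mem_insert _ _, hoy⟩)
  have hyS : y ∉ ({o, p, q} : Set V) := by
    simp only [mem_insert_iff, mem_singleton_iff, not_or]; exact ⟨hoy.symm, hyp, hyq⟩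
  have hoS : o ∈ ({o, p, q} : Set V) := mem_insert _ _
  rw [isForestCfg_insert_iff hoy hf]
  constructor
  · rintro ⟨⟨hF, hnoy⟩, hsep⟩
    have hy : ∀ x' ∈ ({o, p, q} : Set V), ¬ (openGraph ω).Reachable y x' := by
      intro x' hx' h
      have hox' : o = x' := hsep o hoS x' hx' (hoy'.trans (h.mono hle))
      subst hox'
      exact hnoy h.symm
    refine ⟨hF, ?_⟩
    rintro x (rfl | hx) x' (rfl | hx') h
    · rfl
    · exact absurd h (hy x' hx')
    · exact absurd h.symm (hy x hx)
    · exact hsep x hx x' hx' (h.mono hle)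
  · rintro ⟨hF, hsep⟩
    refine ⟨⟨hF, fun h => hoy (hsep o (mem_insert_of_mem _ hoS) y (mem_insert _ _) h)⟩, fun x hx x' hx' h => ?_⟩
    rcases reachable_insert_imp h with h | ⟨-, h⟩ | ⟨h, -⟩
    · exact hsep x (mem_insert_of_mem _ hx) x' (mem_insert_of_mem _ hx') h
    · exact absurd (hsep y (mem_insert _ _) x' (mem_insert_of_mem _ hx') h) fun hyx => hyS (hyx ▸ hx')
    · exact absurd (hsep x (mem_insert_of_mem _ hx) y (mem_insert _ _) h) fun hxy => hyS (hxy ▸ hx)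

/-- A set described by a fibre predicate has the fibre count as cardinality. [cite: Linusson2011, Prop. 2.6] -/
theorem ncard_eq_fibreCount_of_iff (M u : BondConfig V) (A B : Set (BondConfig V)) (T : Set (BondConfig V))
    (h : ∀ ω, ω ∈ T ↔ (ω \ M = u ∧ ω ∈ A ∧ ω ∆ M ∈ B)) : T.ncard = fibreCount M u A B := by
  rw [fibreCount_eq_card_of_iff M u A B (Set.toFinite T).toFinset (fun ω => by rw [Set.Finite.mem_toFinset, h]),
    Set.ncard_eq_toFinset_card T (Set.toFinite T)]

omit [Fintype V] in
/-- On the fibre `(M, u)` with `g ∉ M ∪ u`, no configuration and no partner contains `g`. [folklore] -/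
theorem notMem_of_fibre {M u ω : BondConfig V} {g : Sym2 V} (hω : ω \ M = u) (hgM : g ∉ M) (hgu : g ∉ u) :
    g ∉ ω ∧ g ∉ ω ∆ M := by
  constructor
  · intro h
    have : g ∈ ω \ M := ⟨h, hgM⟩
    rw [hω] at this
    exact hgu this
  · intro h
    rcases Set.mem_symmDiff.1 h with h | h
    · have : g ∈ ω \ M := ⟨h.1, h.2⟩
      rw [hω] at this
      exact hgu this
    · exact hgM h.1

/-- **(QS-K) ⇒ the path-gadget sign fact `n(pq,d;f) ≤ n(d,pq;f)`** in the format of `…PathGadgetAssembly`: `T` = fibre configurations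
containing `f = oy` of type (`pq`, `d`), `T'` = those of type (`d`, `pq`).  Degenerate `y ∈ {o,p,q}` gives `T = ∅`.
[cite: SempleWelsh2008, Conj. 1.1 (p. 2)] [cite: Linusson2011, Prop. 2.6] -/
theorem pathGadget_signFact_of_quotientMono (FM : Set V → Set (BondConfig V))
    (hFM : ∀ (S : Set V) (ω : BondConfig V),
      ω ∈ FM S ↔ IsForestCfg ω ∧ ∀ x ∈ S, ∀ x' ∈ S, (openGraph ω).Reachable x x' → x = x')
    (hQ : ∀ (M' u' K : BondConfig V) (S T : Set V) (y' : V), Disjoint u' M' → K ⊆ M' → S ⊆ T → y' ∉ T →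
      (∀ e ∈ K, ∀ x ∈ e, x ∈ T) →
      fibreCount M' u' (FM S ∩ {ω | K ⊆ ω}) (FM (insert y' T)) ≤ fibreCount M' u' (FM (insert y' S) ∩ {ω | K ⊆ ω}) (FM T))
    (huM : Disjoint u Mf) (hf : s(o, y) ∈ Mf) (hop : o ≠ p) (hoq : o ≠ q) (hpq : p ≠ q)
    (T T' : Set (BondConfig V))
    (hT : ∀ Y, Y ∈ T ↔ Y \ Mf = u ∧ IsForestCfg Y ∧ IsForestCfg (Y ∆ Mf) ∧ s(o, y) ∈ Y ∧
      ((openGraph Y).Reachable p q ∧ ¬ (openGraph Y).Reachable o p ∧ ¬ (openGraph Y).Reachable o q) ∧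
      (∀ x ∈ ({o, p, q} : Set V), ∀ x' ∈ ({o, p, q} : Set V), (openGraph (Y ∆ Mf)).Reachable x x' → x = x'))
    (hT' : ∀ Y, Y ∈ T' ↔ Y \ Mf = u ∧ IsForestCfg Y ∧ IsForestCfg (Y ∆ Mf) ∧ s(o, y) ∈ Y ∧
      (∀ x ∈ ({o, p, q} : Set V), ∀ x' ∈ ({o, p, q} : Set V), (openGraph Y).Reachable x x' → x = x') ∧
      ((openGraph (Y ∆ Mf)).Reachable p q ∧ ¬ (openGraph (Y ∆ Mf)).Reachable o p ∧
        ¬ (openGraph (Y ∆ Mf)).Reachable o q)) :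
    T.ncard ≤ T'.ncard := by
  -- degenerate positions of `y`
  by_cases hdeg : y = o ∨ y = p ∨ y = q
  · have hT0 : T = ∅ := by
      refine Set.eq_empty_iff_forall_notMem.2 fun Y hY => ?_
      rw [hT] at hY
      obtain ⟨-, hYF, -, hfY, ⟨-, hYop, hYoq⟩, -⟩ := hY
      rcases hdeg with rfl | rfl | rfl
      · exact hYF.1 _ hfY rfl
      · exact hYop (Adj.reachable ((openGraph_adj _ _ _).2 ⟨hfY, hop⟩))
      · exact hYoq (Adj.reachable ((openGraph_adj _ _ _).2 ⟨hfY, hoq⟩))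
    rw [hT0, ncard_empty]
    exact Nat.zero_le _
  simp only [not_or] at hdeg
  obtain ⟨hyo, hyp, hyq⟩ := hdeg
  have hoy : o ≠ y := fun h => hyo h.symm
  have hfu : s(o, y) ∉ u := fun h => Set.disjoint_left.1 huM h hf
  -- remove `f` from the fibre
  have hMf : Mf = insert s(o, y) (Mf \ {s(o, y)}) := by rw [insert_sdiff_singleton, insert_eq_of_mem hf]
  have hfM : s(o, y) ∉ Mf \ {s(o, y)} := fun h => h.2 rfl
  have huM' : Disjoint u (Mf \ {s(o, y)}) := huM.mono_right sdiff_subset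
  -- both sides as fibre counts on `(Mf ∖ f, u)`
  have h1 : T.ncard = fibreCount (Mf \ {s(o, y)}) u (FM {o, p, q})
      (forestEv V ∩ {ω | (openGraph ω).Reachable p q ∧ ¬ (openGraph ω).Reachable o p ∧ ¬ (openGraph ω).Reachable o q} ∩
        {ω | ¬ (openGraph ω).Reachable y o ∧ ¬ (openGraph ω).Reachable y p ∧ ¬ (openGraph ω).Reachable y q}) := by
    rw [fibreCount_swap, ncard_eq_fibreCount_of_iff Mf u
      (forestEv V ∩ {Y | s(o, y) ∈ Y} ∩
        {Y | (openGraph Y).Reachable p q ∧ ¬ (openGraph Y).Reachable o p ∧ ¬ (openGraph Y).Reachable o q})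
      (forestEv V ∩ {Y | ∀ x ∈ ({o, p, q} : Set V), ∀ x' ∈ ({o, p, q} : Set V), (openGraph Y).Reachable x x' → x = x'})
      T (fun Y => by rw [hT]; simp only [mem_inter_iff, mem_setOf_eq, forestEv]; tauto)]
    conv_lhs => rw [hMf]
    have hz : fibreCount (Mf \ {s(o, y)}) u
        ({ω | s(o, y) ∉ ω} ∩ (forestEv V ∩ {Y | s(o, y) ∈ Y} ∩
          {Y | (openGraph Y).Reachable p q ∧ ¬ (openGraph Y).Reachable o p ∧ ¬ (openGraph Y).Reachable o q}))
        ({ω | s(o, y) ∉ ω} ∩ {ω | insert s(o, y) ω ∈ forestEv V ∩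
          {Y | ∀ x ∈ ({o, p, q} : Set V), ∀ x' ∈ ({o, p, q} : Set V), (openGraph Y).Reachable x x' → x = x'}}) = 0 :=
      fibreCount_eq_zero_of_left _ _ (Set.eq_empty_iff_forall_notMem.2 fun ω hω => hω.1 hω.2.1.2) _
    rw [fibreCount_insert_one hfM, hz, add_zero]
    refine fibreCount_congr_fibre _ _ fun ω hω => ?_
    obtain ⟨hfω, hfω'⟩ := notMem_of_fibre hω hfM hfu
    simp only [mem_inter_iff, mem_setOf_eq, forestEv, hFM]
    have key := tracePq_insert_iff (p := p) (q := q) hoy hfω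
    constructor
    · rintro ⟨⟨-, ⟨hF, -⟩, htr⟩, -, hF', hsep⟩
      have k := key.1 ⟨hF, htr⟩
      exact ⟨⟨⟨k.1, k.2.1⟩, k.2.2⟩, hF', hsep⟩
    · rintro ⟨⟨⟨hF, htr⟩, hys⟩, hF', hsep⟩
      have k := key.2 ⟨hF, htr, hys⟩
      exact ⟨⟨hfω, ⟨k.1, mem_insert _ _⟩, k.2⟩, hfω', hF', hsep⟩
  have h2 : T'.ncard = fibreCount (Mf \ {s(o, y)}) u (FM (insert y {o, p, q}))
      (forestEv V ∩ {ω | (openGraph ω).Reachable p q ∧ ¬ (openGraph ω).Reachable o p ∧ ¬ (openGraph ω).Reachable o q}) := by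
    rw [ncard_eq_fibreCount_of_iff Mf u
      (forestEv V ∩ {Y | s(o, y) ∈ Y} ∩
        {Y | ∀ x ∈ ({o, p, q} : Set V), ∀ x' ∈ ({o, p, q} : Set V), (openGraph Y).Reachable x x' → x = x'})
      (forestEv V ∩ {Y | (openGraph Y).Reachable p q ∧ ¬ (openGraph Y).Reachable o p ∧ ¬ (openGraph Y).Reachable o q})
      T' (fun Y => by rw [hT']; simp only [mem_inter_iff, mem_setOf_eq, forestEv]; tauto)]
    conv_lhs => rw [hMf]
    have hz : fibreCount (Mf \ {s(o, y)}) u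
        ({ω | s(o, y) ∉ ω} ∩ (forestEv V ∩ {Y | s(o, y) ∈ Y} ∩
          {Y | ∀ x ∈ ({o, p, q} : Set V), ∀ x' ∈ ({o, p, q} : Set V), (openGraph Y).Reachable x x' → x = x'}))
        ({ω | s(o, y) ∉ ω} ∩ {ω | insert s(o, y) ω ∈ forestEv V ∩
          {Y | (openGraph Y).Reachable p q ∧ ¬ (openGraph Y).Reachable o p ∧ ¬ (openGraph Y).Reachable o q}}) = 0 :=
      fibreCount_eq_zero_of_left _ _ (Set.eq_empty_iff_forall_notMem.2 fun ω hω => hω.1 hω.2.1.2) _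
    rw [fibreCount_insert_one hfM, hz, add_zero]
    refine fibreCount_congr_fibre _ _ fun ω hω => ?_
    obtain ⟨hfω, hfω'⟩ := notMem_of_fibre hω hfM hfu
    simp only [mem_inter_iff, mem_setOf_eq, forestEv, hFM]
    have key := traceDisc_insert_iff hoy hyp hyq hfω
    constructor
    · rintro ⟨⟨-, ⟨hF, -⟩, hsep⟩, -, hF', htr⟩
      exact ⟨key.1 ⟨hF, hsep⟩, hF', htr⟩
    · rintro ⟨hA, hF', htr⟩
      exact ⟨⟨hfω, ⟨(key.2 hA).1, mem_insert _ _⟩, (key.2 hA).2⟩, hfω', hF', htr⟩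
  rw [h1, h2]
  exact forest_attach_le_of_quotientMono FM hFM hQ huM' hop hoq hpq hyo

end SignFact

section StarCorollary

open scoped symmDiff

variable {E₁ E₂ : Set (Sym2 V)} {V₁ V₂ : Set V} {M u₀ : BondConfig V} {o p q v y : V}

/-- **(QS-K) ⇒ the node across every star-sided path-gadget 3-separator** (`adjForestNoSq_fibre_of_pathGadget_star` with its
sign-fact hypothesis discharged by `pathGadget_signFact_of_quotientMono`).  Extra hypotheses: the doubled pairs of side 2 miss the
fibre pairs there (true in the node, where `u₀ ∩ M = ∅` and `f ∉ u₀` may be assumed).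
[cite: SempleWelsh2008, Conj. 1.1 (p. 2)] [cite: Linusson2011, Prop. 2.6] [cite: Grimmett2006, §3.8 (pp. 61–62)] -/
theorem adjForestNoSq_fibre_of_pathGadget_star_of_quotientMono (FM : Set V → Set (BondConfig V))
    (hFM : ∀ (S : Set V) (ω : BondConfig V),
      ω ∈ FM S ↔ IsForestCfg ω ∧ ∀ x ∈ S, ∀ x' ∈ S, (openGraph ω).Reachable x x' → x = x')
    (hQ : ∀ (M' u' K : BondConfig V) (S T : Set V) (y' : V), Disjoint u' M' → K ⊆ M' → S ⊆ T → y' ∉ T →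
      (∀ e ∈ K, ∀ x ∈ e, x ∈ T) →
      fibreCount M' u' (FM S ∩ {ω | K ⊆ ω}) (FM (insert y' T)) ≤ fibreCount M' u' (FM (insert y' S) ∩ {ω | K ⊆ ω}) (FM T))
    (hop : o ≠ p) (hoq : o ≠ q) (hpq : p ≠ q)
    (h₁ : ∀ e ∈ E₁, ∀ z ∈ e, z ∈ V₁) (h₂ : ∀ e ∈ E₂, ∀ z ∈ e, z ∈ V₂) (hS : V₁ ∩ V₂ ⊆ ({o, p, q} : Set V))
    (hd : Disjoint E₁ E₂) (hn₁ : ∀ x ∈ ({o, p, q} : Set V), ∀ x' ∈ ({o, p, q} : Set V), s(x, x') ∉ E₁)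
    (hn₂ : ∀ x ∈ ({o, p, q} : Set V), ∀ x' ∈ ({o, p, q} : Set V), s(x, x') ∉ E₂)
    (heE : s(o, v) ∈ E₁) (hfE : s(o, y) ∈ E₂)
    (hM' : insert s(o, y) (insert s(o, v) M) ∪ u₀ ⊆ ({s(o, p), s(o, q)} : Set (Sym2 V)) ∪ (E₁ ∪ E₂))
    (hgp : s(o, p) ∈ insert s(o, y) (insert s(o, v) M)) (hgq : s(o, q) ∈ insert s(o, y) (insert s(o, v) M))
    (hu₂ : Disjoint (u₀ ∩ E₂) (insert s(o, y) (insert s(o, v) M) ∩ E₂))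
    (Rset Res : Set (BondConfig V))
    (hRset : ∀ ω, ω ∈ Rset ↔
      ((¬ ∀ x ∈ ({o, p, q} : Set V), ∀ x' ∈ ({o, p, q} : Set V),
        (openGraph (ω ∩ E₁)).Reachable x x' ↔ (openGraph ((ω ∆ insert s(o, y) (insert s(o, v) M)) ∩ E₁)).Reachable x x') ∧
      (¬ ∀ x ∈ ({o, p, q} : Set V), ∀ x' ∈ ({o, p, q} : Set V),
        (openGraph (ω ∩ E₂)).Reachable x x' ↔ (openGraph ((ω ∆ insert s(o, y) (insert s(o, v) M)) ∩ E₂)).Reachable x x')))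
    (hRes : ∀ ω, ω ∈ Res ↔
      (((openGraph (ω ∩ E₂)).Reachable p q ∧ (openGraph ((ω ∆ insert s(o, y) (insert s(o, v) M)) ∩ E₁)).Reachable p q) ∨
      ((openGraph (ω ∩ E₁)).Reachable p q ∧ (openGraph ((ω ∆ insert s(o, y) (insert s(o, v) M)) ∩ E₂)).Reachable p q)))
    (hstar : ∀ g ∈ E₁, v ∈ g) :
    fibreCount (insert s(o, y) (insert s(o, v) M)) u₀ (forestEv V ∩ {ω | s(o, v) ∈ ω ∧ s(o, y) ∈ ω}) (forestEv V) ≤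
      fibreCount (insert s(o, y) (insert s(o, v) M)) u₀ (forestEv V ∩ {ω | s(o, v) ∈ ω}) (forestEv V ∩ {ω | s(o, y) ∈ ω}) := by
  set Mf := insert s(o, y) (insert s(o, v) M) with hMfdef
  set T₂ : Set (BondConfig V) := {Y | Y ⊆ E₂ ∧ Y \ (Mf ∩ E₂) = u₀ ∩ E₂ ∧ IsForestCfg Y ∧ IsForestCfg (Y ∆ (Mf ∩ E₂)) ∧
      s(o, y) ∈ Y ∧ ((openGraph Y).Reachable p q ∧ ¬ (openGraph Y).Reachable o p ∧ ¬ (openGraph Y).Reachable o q) ∧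
      (∀ x ∈ ({o, p, q} : Set V), ∀ x' ∈ ({o, p, q} : Set V), (openGraph (Y ∆ (Mf ∩ E₂))).Reachable x x' → x = x')}
    with hT₂def
  set T₂' : Set (BondConfig V) := {Y | Y ⊆ E₂ ∧ Y \ (Mf ∩ E₂) = u₀ ∩ E₂ ∧ IsForestCfg Y ∧ IsForestCfg (Y ∆ (Mf ∩ E₂)) ∧
      s(o, y) ∈ Y ∧ (∀ x ∈ ({o, p, q} : Set V), ∀ x' ∈ ({o, p, q} : Set V), (openGraph Y).Reachable x x' → x = x') ∧
      ((openGraph (Y ∆ (Mf ∩ E₂))).Reachable p q ∧ ¬ (openGraph (Y ∆ (Mf ∩ E₂))).Reachable o p ∧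
        ¬ (openGraph (Y ∆ (Mf ∩ E₂))).Reachable o q)} with hT₂'def
  -- `Y ⊆ E₂` is automatic on the side-2 fibre
  have hsub : ∀ Y : BondConfig V, Y \ (Mf ∩ E₂) = u₀ ∩ E₂ → Y ⊆ E₂ := by
    intro Y hY x hx
    by_cases hxM : x ∈ Mf ∩ E₂
    · exact hxM.2
    · have : x ∈ Y \ (Mf ∩ E₂) := ⟨hx, hxM⟩
      rw [hY] at this
      exact this.2
  have hle₂ : T₂.ncard ≤ T₂'.ncard :=
    pathGadget_signFact_of_quotientMono FM hFM hQ hu₂ ⟨mem_insert _ _, hfE⟩ hop hoq hpq T₂ T₂'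
      (fun Y => ⟨fun h => h.2, fun h => ⟨hsub Y h.1, h⟩⟩) (fun Y => ⟨fun h => h.2, fun h => ⟨hsub Y h.1, h⟩⟩)
  exact adjForestNoSq_fibre_of_pathGadget_star hop hoq hpq h₁ h₂ hS hd hn₁ hn₂ heE hfE hM' hgp hgq Rset Res hRset hRes hstar
    T₂ T₂' (fun Y => Iff.rfl) (fun Y => Iff.rfl) hle₂

/-- **(QS-K) ⇒ the node across EVERY path-gadget 3-separator** (both sides arbitrary): both one-side sign facts of
`adjForestNoSq_fibre_of_pathGadget_signFacts` are instances of `pathGadget_signFact_of_quotientMono` (side 1 with the pinned pair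
`e = ov`, side 2 with `f = oy`).  Extra hypotheses: on each side the doubled pairs miss the fibre pairs.
[cite: SempleWelsh2008, Conj. 1.1 (p. 2)] [cite: Linusson2011, Prop. 2.6] [cite: Grimmett2006, §3.8 (pp. 61–62)] -/
theorem adjForestNoSq_fibre_of_pathGadget_of_quotientMono (FM : Set V → Set (BondConfig V))
    (hFM : ∀ (S : Set V) (ω : BondConfig V),
      ω ∈ FM S ↔ IsForestCfg ω ∧ ∀ x ∈ S, ∀ x' ∈ S, (openGraph ω).Reachable x x' → x = x')
    (hQ : ∀ (M' u' K : BondConfig V) (S T : Set V) (y' : V), Disjoint u' M' → K ⊆ M' → S ⊆ T → y' ∉ T →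
      (∀ e ∈ K, ∀ x ∈ e, x ∈ T) →
      fibreCount M' u' (FM S ∩ {ω | K ⊆ ω}) (FM (insert y' T)) ≤ fibreCount M' u' (FM (insert y' S) ∩ {ω | K ⊆ ω}) (FM T))
    (hop : o ≠ p) (hoq : o ≠ q) (hpq : p ≠ q)
    (h₁ : ∀ e ∈ E₁, ∀ z ∈ e, z ∈ V₁) (h₂ : ∀ e ∈ E₂, ∀ z ∈ e, z ∈ V₂) (hS : V₁ ∩ V₂ ⊆ ({o, p, q} : Set V))
    (hd : Disjoint E₁ E₂) (hn₁ : ∀ x ∈ ({o, p, q} : Set V), ∀ x' ∈ ({o, p, q} : Set V), s(x, x') ∉ E₁)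
    (hn₂ : ∀ x ∈ ({o, p, q} : Set V), ∀ x' ∈ ({o, p, q} : Set V), s(x, x') ∉ E₂)
    (heE : s(o, v) ∈ E₁) (hfE : s(o, y) ∈ E₂)
    (hM' : insert s(o, y) (insert s(o, v) M) ∪ u₀ ⊆ ({s(o, p), s(o, q)} : Set (Sym2 V)) ∪ (E₁ ∪ E₂))
    (hgp : s(o, p) ∈ insert s(o, y) (insert s(o, v) M)) (hgq : s(o, q) ∈ insert s(o, y) (insert s(o, v) M))
    (hu₁ : Disjoint (u₀ ∩ E₁) (insert s(o, y) (insert s(o, v) M) ∩ E₁))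
    (hu₂ : Disjoint (u₀ ∩ E₂) (insert s(o, y) (insert s(o, v) M) ∩ E₂))
    (Rset Res : Set (BondConfig V))
    (hRset : ∀ ω, ω ∈ Rset ↔
      ((¬ ∀ x ∈ ({o, p, q} : Set V), ∀ x' ∈ ({o, p, q} : Set V),
        (openGraph (ω ∩ E₁)).Reachable x x' ↔ (openGraph ((ω ∆ insert s(o, y) (insert s(o, v) M)) ∩ E₁)).Reachable x x') ∧
      (¬ ∀ x ∈ ({o, p, q} : Set V), ∀ x' ∈ ({o, p, q} : Set V),
        (openGraph (ω ∩ E₂)).Reachable x x' ↔ (openGraph ((ω ∆ insert s(o, y) (insert s(o, v) M)) ∩ E₂)).Reachable x x')))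
    (hRes : ∀ ω, ω ∈ Res ↔
      (((openGraph (ω ∩ E₂)).Reachable p q ∧ (openGraph ((ω ∆ insert s(o, y) (insert s(o, v) M)) ∩ E₁)).Reachable p q) ∨
      ((openGraph (ω ∩ E₁)).Reachable p q ∧ (openGraph ((ω ∆ insert s(o, y) (insert s(o, v) M)) ∩ E₂)).Reachable p q))) :
    fibreCount (insert s(o, y) (insert s(o, v) M)) u₀ (forestEv V ∩ {ω | s(o, v) ∈ ω ∧ s(o, y) ∈ ω}) (forestEv V) ≤
      fibreCount (insert s(o, y) (insert s(o, v) M)) u₀ (forestEv V ∩ {ω | s(o, v) ∈ ω}) (forestEv V ∩ {ω | s(o, y) ∈ ω}) := by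
  set Mf := insert s(o, y) (insert s(o, v) M) with hMfdef
  have hsub : ∀ (E : Set (Sym2 V)) (Y : BondConfig V), Y \ (Mf ∩ E) = u₀ ∩ E → Y ⊆ E := by
    intro E Y hY x hx
    by_cases hxM : x ∈ Mf ∩ E
    · exact hxM.2
    · have : x ∈ Y \ (Mf ∩ E) := ⟨hx, hxM⟩
      rw [hY] at this
      exact this.2
  set T₁ : Set (BondConfig V) := {X | X ⊆ E₁ ∧ X \ (Mf ∩ E₁) = u₀ ∩ E₁ ∧ IsForestCfg X ∧ IsForestCfg (X ∆ (Mf ∩ E₁)) ∧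
      s(o, v) ∈ X ∧ ((openGraph X).Reachable p q ∧ ¬ (openGraph X).Reachable o p ∧ ¬ (openGraph X).Reachable o q) ∧
      (∀ x ∈ ({o, p, q} : Set V), ∀ x' ∈ ({o, p, q} : Set V), (openGraph (X ∆ (Mf ∩ E₁))).Reachable x x' → x = x')}
    with hT₁def
  set T₁' : Set (BondConfig V) := {X | X ⊆ E₁ ∧ X \ (Mf ∩ E₁) = u₀ ∩ E₁ ∧ IsForestCfg X ∧ IsForestCfg (X ∆ (Mf ∩ E₁)) ∧
      s(o, v) ∈ X ∧ (∀ x ∈ ({o, p, q} : Set V), ∀ x' ∈ ({o, p, q} : Set V), (openGraph X).Reachable x x' → x = x') ∧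
      ((openGraph (X ∆ (Mf ∩ E₁))).Reachable p q ∧ ¬ (openGraph (X ∆ (Mf ∩ E₁))).Reachable o p ∧
        ¬ (openGraph (X ∆ (Mf ∩ E₁))).Reachable o q)} with hT₁'def
  set T₂ : Set (BondConfig V) := {Y | Y ⊆ E₂ ∧ Y \ (Mf ∩ E₂) = u₀ ∩ E₂ ∧ IsForestCfg Y ∧ IsForestCfg (Y ∆ (Mf ∩ E₂)) ∧
      s(o, y) ∈ Y ∧ ((openGraph Y).Reachable p q ∧ ¬ (openGraph Y).Reachable o p ∧ ¬ (openGraph Y).Reachable o q) ∧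
      (∀ x ∈ ({o, p, q} : Set V), ∀ x' ∈ ({o, p, q} : Set V), (openGraph (Y ∆ (Mf ∩ E₂))).Reachable x x' → x = x')}
    with hT₂def
  set T₂' : Set (BondConfig V) := {Y | Y ⊆ E₂ ∧ Y \ (Mf ∩ E₂) = u₀ ∩ E₂ ∧ IsForestCfg Y ∧ IsForestCfg (Y ∆ (Mf ∩ E₂)) ∧
      s(o, y) ∈ Y ∧ (∀ x ∈ ({o, p, q} : Set V), ∀ x' ∈ ({o, p, q} : Set V), (openGraph Y).Reachable x x' → x = x') ∧
      ((openGraph (Y ∆ (Mf ∩ E₂))).Reachable p q ∧ ¬ (openGraph (Y ∆ (Mf ∩ E₂))).Reachable o p ∧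
        ¬ (openGraph (Y ∆ (Mf ∩ E₂))).Reachable o q)} with hT₂'def
  have hle₁ : T₁.ncard ≤ T₁'.ncard :=
    pathGadget_signFact_of_quotientMono FM hFM hQ hu₁ ⟨mem_insert_of_mem _ (mem_insert _ _), heE⟩ hop hoq hpq T₁ T₁'
      (fun X => ⟨fun h => h.2, fun h => ⟨hsub E₁ X h.1, h⟩⟩) (fun X => ⟨fun h => h.2, fun h => ⟨hsub E₁ X h.1, h⟩⟩)
  have hle₂ : T₂.ncard ≤ T₂'.ncard :=
    pathGadget_signFact_of_quotientMono FM hFM hQ hu₂ ⟨mem_insert _ _, hfE⟩ hop hoq hpq T₂ T₂'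
      (fun Y => ⟨fun h => h.2, fun h => ⟨hsub E₂ Y h.1, h⟩⟩) (fun Y => ⟨fun h => h.2, fun h => ⟨hsub E₂ Y h.1, h⟩⟩)
  exact adjForestNoSq_fibre_of_pathGadget_signFacts hop hoq hpq h₁ h₂ hS hd hn₁ hn₂ heE hfE hM' hgp hgq Rset Res hRset hRes
    T₁ T₁' (fun X => Iff.rfl) (fun X => Iff.rfl) T₂ T₂' (fun Y => Iff.rfl) (fun Y => Iff.rfl) hle₁ hle₂

end StarCorollary

end FK

end Summit.CriticalPhenomena.PercolationContinuityZ3.Theorems
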